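import Summits.NavierStokesRegularity.FunctionalMining.TopEigChannelIntegralSimple
import Summits.NavierStokesRegularity.FunctionalMining.TopEigDensityRForm
import HarnessLib

/-!
# FunctionalMining — Lemma L-λ, brick N14b at a simple point: the heat-price density of `Φ_q`
# CHARGES THE `e₁`-COLUMN OF `∇S`: density `≥ (2q/3) λ₁^{q−2} ∑ₖ |S(∂ₖv) e₁|²`

Search for candidate a priori estimates; no regularity claim. Cell `pub-nsfunc`, prove seat
(gen 25). Support toward the dictionary's typed node `TopEigGapCoerciveTwo η` /
`TopEigGapCoercivePos q η` (Proposition L-λ(η), `TopEigHeatCoerciveGap.lean`; proved on paper by the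
no-go seat, SIEVELD §3.4b (4), NOT kernel): the first step of the pen proof is the no-go seat's
identity/inequality N14b, "`D₀ = q(q−1)∫λ₁^{q−2}|∇λ₁|² + 2q∫λ₁^{q−1}∑_{j=2,3}(λ₁−λ_j)|e_j·∇e₁|² ≥
(2q/3)∫λ₁^{q−2}|(∇S)e₁|²`: the heat flow charges the `e₁`-column of `∇S` and nothing transverse".
THIS FILE proves its POINTWISE form at every point of the simple set `U_s = {λ₂ < λ₁}`, in the
R-form vocabulary of `TopEigDensityRForm` (Mathlib's orthonormal eigenbasis `u_a` of `S(v)(x)` with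
eigenvalues `κ_a`, top index `a₀`, `u₀ := u_{a₀}`):

* `eigenvalues_ge_neg_two_mul_topEig` — `κ_a ≥ −2λ₁(x)` for the strain of a divergence-free field
  (`tr S = ∑κ_a = 0`, every `κ_a ≤ λ₁`), hence `0 < λ₁ − κ_a ≤ 3λ₁` for `a ≠ a₀` on `U_s`;
* `sum_sq_frame_eq_column_sq` — Parseval in the eigenbasis: `∑_a (u_aᵀ M u₀)² = |M u₀|²`;
* **`channelIntegrand_ge_column_sq`** — for `v` smooth and divergence free, `q ≥ 5/3`, at every
  `x ∈ U_s`: the Cor. 3′(a) density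
  `q(q−1)λ₁^{q−2}∑ₖ(∂ₖλ₁)² + qλ₁^{q−1}(Δλ₁ − μ(S;ΔS)) ≥ (2q/3) λ₁^{q−2} ∑ₖ |S(∂ₖv)(x) u₀|²`
  (Hellmann–Feynman `∂ₖλ₁ = u₀ᵀS(∂ₖv)u₀`, the R-form
  `Δλ₁ − μ = 2∑ₖ∑_{a≠a₀}(u_aᵀS(∂ₖv)u₀)²/(λ₁−κ_a)` with `λ₁ − κ_a ≤ 3λ₁`, and `q − 1 ≥ 2/3`).

The integrated form along fields with `λ₂ < λ₁` everywhere follows with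
`heatDissipation_topEigMoment_eq_integral_of_midEig_lt`; the gap class, the projector derivative
and the Poincaré step of L-λ(η) are NOT here (plan: prove seat HANDOFF GEN 25 (C)). Nothing is claimed
about L-λ itself. [ours]
-/

noncomputable section

open Filter Topology Matrix Finset MeasureTheory

namespace Summit.NavierStokesRegularity.FunctionalMining

open Literature.Analysis Literature.Analysis.FunctionSpaces Literature.Analysis.FunctionSpaces.Torus
  Literature.Analysis.Matrix

namespace TopEig

variable {v : UnitAddTorus (Fin 3) → EuclideanSpace ℝ (Fin 3)}

/-! ## 1. Eigenvalue bookkeeping on the simple set -/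

/-- **Every eigenbasis eigenvalue is `≤ λ₁(x)`** at a point of `U_s` (`κ_{a₀} = λ₁`, the others are
`≤ λ₂ < λ₁`). [ours, bookkeeping] -/
theorem eigenvalues_le_topEig_of_midEig_lt {x : UnitAddTorus (Fin 3)}
    (hx : torusStrainMidEig v x < torusStrainTopEig v x) {a₀ : Fin 3}
    (ha₀ : (torusStrainMatrix_isHermitian v x).eigenvalues a₀ = torusStrainTopEig v x) (a : Fin 3) :
    (torusStrainMatrix_isHermitian v x).eigenvalues a ≤ torusStrainTopEig v x := by
  by_cases ha : a = a₀
  · rw [ha, ha₀]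
  · exact (eigenvalues_le_midEig_of_ne hx ha₀ ha).trans hx.le

/-- **`κ_a ≥ −2λ₁(x)` for the strain of a divergence-free field** at a point of `U_s`:
`∑_b κ_b = tr S(v)(x) = div v(x) = 0` and every `κ_b ≤ λ₁(x)`. [ours, bookkeeping] -/
theorem eigenvalues_ge_neg_two_mul_topEig (hv : Torus.IsSmooth v) (hdiv : Torus.IsDivFree v)
    {x : UnitAddTorus (Fin 3)} (hx : torusStrainMidEig v x < torusStrainTopEig v x) {a₀ : Fin 3}
    (ha₀ : (torusStrainMatrix_isHermitian v x).eigenvalues a₀ = torusStrainTopEig v x) (a : Fin 3) :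
    -(2 * torusStrainTopEig v x) ≤ (torusStrainMatrix_isHermitian v x).eigenvalues a := by
  set hS := torusStrainMatrix_isHermitian v x
  have htr : (torusStrainMatrix v x).trace = ∑ b, hS.eigenvalues b := by
    have h := hS.trace_eq_sum_eigenvalues
    simpa using h
  have h0 : ∑ b, hS.eigenvalues b = 0 := by
    rw [← htr]; exact torusStrainMatrix_trace_eq_zero hv hdiv x
  have hsplit := Finset.add_sum_erase Finset.univ (fun b => hS.eigenvalues b) (Finset.mem_univ a)
  have hle : ∑ b ∈ Finset.univ.erase a, hS.eigenvalues b ≤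
      ∑ b ∈ Finset.univ.erase a, torusStrainTopEig v x :=
    Finset.sum_le_sum fun b _ => eigenvalues_le_topEig_of_midEig_lt hx ha₀ b
  rw [Finset.sum_const, Finset.card_erase_of_mem (Finset.mem_univ a), Finset.card_univ,
    Fintype.card_fin, nsmul_eq_mul] at hle
  norm_num at hle
  linarith

/-- On `U_s`, for `a ≠ a₀`: **`0 < λ₁ − κ_a ≤ 3λ₁`**. [ours, bookkeeping] -/
theorem topEig_sub_eigenvalues_pos_le (hv : Torus.IsSmooth v) (hdiv : Torus.IsDivFree v)
    {x : UnitAddTorus (Fin 3)} (hx : torusStrainMidEig v x < torusStrainTopEig v x) {a₀ a : Fin 3}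
    (ha₀ : (torusStrainMatrix_isHermitian v x).eigenvalues a₀ = torusStrainTopEig v x) (ha : a ≠ a₀) :
    0 < torusStrainTopEig v x - (torusStrainMatrix_isHermitian v x).eigenvalues a ∧
      torusStrainTopEig v x - (torusStrainMatrix_isHermitian v x).eigenvalues a ≤
        3 * torusStrainTopEig v x := by
  have h1 := eigenvalues_le_midEig_of_ne hx ha₀ ha
  have h2 := eigenvalues_ge_neg_two_mul_topEig hv hdiv hx ha₀ a
  constructor <;> linarith

/-! ## 2. Parseval in the eigenbasis -/

/-- **`∑_a (u_aᵀ w)² = |w|²`** and hence `∑_a (u_aᵀ M u₀)² = |M u₀|²` — Parseval in the orthonormal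
eigenbasis (tree `KyFan.dotProduct_self_eq_sum_sq`). [ours, bookkeeping] -/
theorem sum_sq_frame_eq_column_sq (x : UnitAddTorus (Fin 3)) (M : Matrix (Fin 3) (Fin 3) ℝ)
    (w : Fin 3 → ℝ) :
    ∑ a, (((torusStrainMatrix_isHermitian v x).eigenvectorBasis a).ofLp ⬝ᵥ (M *ᵥ w)) ^ 2 =
      (M *ᵥ w) ⬝ᵥ (M *ᵥ w) :=
  (KyFan.dotProduct_self_eq_sum_sq (torusStrainMatrix_isHermitian v x) (M *ᵥ w)).symm

/-! ## 3. The column charge at a simple point -/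

/-- **N14b, POINTWISE: the heat-price density charges the `e₁`-column of `∇S`.** Let `v` be smooth and
divergence free on `T³`, `q ≥ 5/3`, `x ∈ U_s` (`λ₂(x) < λ₁(x)`), `a₀` a basis index with
`κ_{a₀} = λ₁(x)` and `u₀ := u_{a₀}`. Then the Cor. 3′(a) density satisfies
`q(q−1)λ₁^{q−2}∑ₖ(∂ₖλ₁)² + qλ₁^{q−1}(Δλ₁ − μ(S;ΔS)) ≥ (2q/3)·λ₁^{q−2}·∑ₖ |S(∂ₖv)(x)u₀|²`.
Proof: `∂ₖλ₁ = u₀ᵀSₖu₀` (`Sₖ := S(∂ₖv)(x)`), `Δλ₁ − μ = 2∑ₖ∑_{a≠a₀}(u_aᵀSₖu₀)²/(λ₁−κ_a)` with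
`0 < λ₁−κ_a ≤ 3λ₁`, so the density is `≥ qλ₁^{q−2}[(q−1)∑ₖ(u₀ᵀSₖu₀)² + (2/3)∑ₖ∑_{a≠a₀}(u_aᵀSₖu₀)²]
≥ (2q/3)λ₁^{q−2}∑ₖ∑_a(u_aᵀSₖu₀)²`, and Parseval. [ours; the no-go seat's N14b (SIEVELD §3.4b) at a point] -/
theorem channelIntegrand_ge_column_sq {q : ℝ} (hq : 5 / 3 ≤ q) (hv : Torus.IsSmooth v)
    (hdiv : Torus.IsDivFree v) {x : UnitAddTorus (Fin 3)}
    (hx : torusStrainMidEig v x < torusStrainTopEig v x) {a₀ : Fin 3}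
    (ha₀ : (torusStrainMatrix_isHermitian v x).eigenvalues a₀ = torusStrainTopEig v x) :
    2 * q / 3 * torusStrainTopEig v x ^ (q - 2) *
        ∑ k, (torusStrainMatrix (Torus.partialDeriv k v) x *ᵥ
              ((torusStrainMatrix_isHermitian v x).eigenvectorBasis a₀).ofLp) ⬝ᵥ
            (torusStrainMatrix (Torus.partialDeriv k v) x *ᵥ
              ((torusStrainMatrix_isHermitian v x).eigenvectorBasis a₀).ofLp) ≤
      q * (q - 1) * torusStrainTopEig v x ^ (q - 2) *
          ∑ k, Torus.partialDeriv k (torusStrainTopEig v) x ^ 2 +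
        q * torusStrainTopEig v x ^ (q - 1) * (Torus.laplacian (torusStrainTopEig v) x -
          dirTopEig (StrainL4.strainFlat v x) (StrainL4.strainFlat (Torus.laplacian v) x)) := by
  set hS := torusStrainMatrix_isHermitian v x with hSdef
  set lam : ℝ := torusStrainTopEig v x with hlam
  set u : Fin 3 → Fin 3 → ℝ := fun a => (hS.eigenvectorBasis a).ofLp with hu
  set Sk : Fin 3 → Matrix (Fin 3) (Fin 3) ℝ := fun k => torusStrainMatrix (Torus.partialDeriv k v) x
    with hSk
  -- gap form at `u a₀`, positivity of `λ₁`
  obtain ⟨he1, hSe, hgap⟩ := gapForm_eigenvectorBasis hx ha₀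
  have hg : 0 < torusStrainTopEig v x - torusStrainMidEig v x := sub_pos.2 hx
  have hlam0 : 0 < lam := (lam_pos_of_gapForm_of_isDivFree hv hdiv he1 hSe hg hgap).2
  -- Hellmann–Feynman and the R-form
  have hHF : ∀ k, Torus.partialDeriv k (torusStrainTopEig v) x = u a₀ ⬝ᵥ (Sk k *ᵥ u a₀) := fun k =>
    (partialDeriv_partialDeriv_torusStrainTopEig_eq_sum_frame hv hx ha₀ k).1
  have hR := laplacian_torusStrainTopEig_eq_sum_frame hv hx ha₀
  have hμ : dirTopEig (StrainL4.strainFlat v x) (StrainL4.strainFlat (Torus.laplacian v) x) =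
      u a₀ ⬝ᵥ (torusStrainMatrix (Torus.laplacian v) x *ᵥ u a₀) :=
    dirTopEig_strainFlat_eq_of_gapForm he1 hSe hg hgap (Torus.laplacian v)
  -- `Δλ₁ − μ = 2 ∑ₖ ∑_{a ≠ a₀} (u_aᵀ Sₖ u₀)² / (λ₁ − κ_a)`
  have hdiff : Torus.laplacian (torusStrainTopEig v) x -
      dirTopEig (StrainL4.strainFlat v x) (StrainL4.strainFlat (Torus.laplacian v) x) =
      2 * ∑ k, ∑ a ∈ Finset.univ.erase a₀,
        (u a ⬝ᵥ (Sk k *ᵥ u a₀)) ^ 2 / (lam - hS.eigenvalues a) := by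
    rw [hμ, hR]; ring
  -- each channel with `a ≠ a₀`: `(…)²/(λ₁−κ_a) ≥ (…)²/(3λ₁)`
  have hchan : ∀ k, ∀ a ∈ Finset.univ.erase a₀,
      (u a ⬝ᵥ (Sk k *ᵥ u a₀)) ^ 2 / (3 * lam) ≤ (u a ⬝ᵥ (Sk k *ᵥ u a₀)) ^ 2 / (lam - hS.eigenvalues a) := by
    intro k a ha
    have ha' : a ≠ a₀ := Finset.ne_of_mem_erase ha
    obtain ⟨hpos, hle⟩ := topEig_sub_eigenvalues_pos_le hv hdiv hx ha₀ ha'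
    exact div_le_div_of_nonneg_left (sq_nonneg _) hpos hle
  -- the `a₀`-term: `(u₀ᵀ Sₖ u₀)² = (∂ₖλ₁)²`
  -- assemble: `∑ₖ |Sₖu₀|² = ∑ₖ [(u₀ᵀSₖu₀)² + ∑_{a≠a₀}(u_aᵀSₖu₀)²]`
  have hpars : ∀ k, (Sk k *ᵥ u a₀) ⬝ᵥ (Sk k *ᵥ u a₀) =
      (u a₀ ⬝ᵥ (Sk k *ᵥ u a₀)) ^ 2 + ∑ a ∈ Finset.univ.erase a₀, (u a ⬝ᵥ (Sk k *ᵥ u a₀)) ^ 2 := by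
    intro k
    rw [← sum_sq_frame_eq_column_sq x (Sk k) (u a₀),
      ← Finset.add_sum_erase Finset.univ _ (Finset.mem_univ a₀)]
  have hq0 : 0 < q := by linarith
  have hq1 : 2 / 3 ≤ q - 1 := by linarith
  have hp2 : 0 ≤ lam ^ (q - 2) := Real.rpow_nonneg hlam0.le _
  have hp1 : lam ^ (q - 1) = lam ^ (q - 2) * lam := by
    rw [show q - 1 = (q - 2) + 1 by ring, Real.rpow_add hlam0, Real.rpow_one]
  -- lower bound of the channel part
  have hA : ∀ k, 2 / (3 * lam) * ∑ a ∈ Finset.univ.erase a₀, (u a ⬝ᵥ (Sk k *ᵥ u a₀)) ^ 2 ≤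
      2 * ∑ a ∈ Finset.univ.erase a₀, (u a ⬝ᵥ (Sk k *ᵥ u a₀)) ^ 2 / (lam - hS.eigenvalues a) := by
    intro k
    rw [Finset.mul_sum, Finset.mul_sum]
    refine Finset.sum_le_sum fun a ha => ?_
    have h := hchan k a ha
    have e : 2 / (3 * lam) * (u a ⬝ᵥ (Sk k *ᵥ u a₀)) ^ 2 = 2 * ((u a ⬝ᵥ (Sk k *ᵥ u a₀)) ^ 2 / (3 * lam)) := by
      ring
    rw [e]; linarith
  -- the main chain, with `A := ∑ₖ(u₀ᵀSₖu₀)²`, `B := ∑ₖ∑_{a≠a₀}(u_aᵀSₖu₀)²`, `Bw :=` the weighted sum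
  set A : ℝ := ∑ k, (u a₀ ⬝ᵥ (Sk k *ᵥ u a₀)) ^ 2 with hAdef
  set B : ℝ := ∑ k, ∑ a ∈ Finset.univ.erase a₀, (u a ⬝ᵥ (Sk k *ᵥ u a₀)) ^ 2 with hBdef
  set Bw : ℝ := ∑ k, ∑ a ∈ Finset.univ.erase a₀,
    (u a ⬝ᵥ (Sk k *ᵥ u a₀)) ^ 2 / (lam - hS.eigenvalues a) with hBwdef
  have hA0 : 0 ≤ A := Finset.sum_nonneg fun k _ => sq_nonneg _
  have hB0 : 0 ≤ B := Finset.sum_nonneg fun k _ => Finset.sum_nonneg fun a _ => sq_nonneg _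
  have hcol : ∑ k, (Sk k *ᵥ u a₀) ⬝ᵥ (Sk k *ᵥ u a₀) = A + B := by
    rw [hAdef, hBdef, ← Finset.sum_add_distrib]
    exact Finset.sum_congr rfl fun k _ => hpars k
  have hBle : 2 / (3 * lam) * B ≤ 2 * Bw := by
    rw [hBdef, hBwdef, Finset.mul_sum, Finset.mul_sum]
    exact Finset.sum_le_sum fun k _ => hA k
  -- the density in terms of `A` and `Bw`
  have hdens : q * (q - 1) * torusStrainTopEig v x ^ (q - 2) *
          ∑ k, Torus.partialDeriv k (torusStrainTopEig v) x ^ 2 +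
        q * torusStrainTopEig v x ^ (q - 1) * (Torus.laplacian (torusStrainTopEig v) x -
          dirTopEig (StrainL4.strainFlat v x) (StrainL4.strainFlat (Torus.laplacian v) x)) =
      q * (q - 1) * lam ^ (q - 2) * A + q * lam ^ (q - 1) * (2 * Bw) := by
    rw [hdiff]
    simp_rw [hHF]
    rfl
  rw [hdens, hcol]
  -- the two halves
  have h1 : 2 * q / 3 * lam ^ (q - 2) * A ≤ q * (q - 1) * lam ^ (q - 2) * A := by
    have e : q * (q - 1) * lam ^ (q - 2) * A - 2 * q / 3 * lam ^ (q - 2) * A =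
        q * lam ^ (q - 2) * A * ((q - 1) - 2 / 3) := by ring
    have h13 : 0 ≤ (q - 1) - 2 / 3 := by linarith
    have : 0 ≤ q * lam ^ (q - 2) * A * ((q - 1) - 2 / 3) :=
      mul_nonneg (mul_nonneg (mul_nonneg hq0.le hp2) hA0) h13
    linarith
  have h2 : 2 * q / 3 * lam ^ (q - 2) * B ≤ q * lam ^ (q - 1) * (2 * Bw) := by
    have hl : lam ≠ 0 := hlam0.ne'
    have e3 : lam * (2 / (3 * lam)) = 2 / 3 := by
      field_simp
    have e : 2 * q / 3 * lam ^ (q - 2) * B = q * lam ^ (q - 1) * (2 / (3 * lam) * B) := by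
      rw [hp1]
      calc 2 * q / 3 * lam ^ (q - 2) * B = q * lam ^ (q - 2) * (2 / 3) * B := by ring
        _ = q * lam ^ (q - 2) * (lam * (2 / (3 * lam))) * B := by rw [e3]
        _ = q * (lam ^ (q - 2) * lam) * (2 / (3 * lam) * B) := by ring
    rw [e]
    have hc : 0 ≤ q * lam ^ (q - 1) := mul_nonneg hq0.le (Real.rpow_nonneg hlam0.le _)
    exact mul_le_mul_of_nonneg_left hBle hc
  calc 2 * q / 3 * lam ^ (q - 2) * (A + B)
      = 2 * q / 3 * lam ^ (q - 2) * A + 2 * q / 3 * lam ^ (q - 2) * B := by ring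
    _ ≤ q * (q - 1) * lam ^ (q - 2) * A + q * lam ^ (q - 1) * (2 * Bw) := add_le_add h1 h2

/-! ## 4. Integrated form on fields with `λ₂ < λ₁` everywhere -/

/-- A basis index carrying the top eigenvalue `λ₁(x)` (a choice; `exists_eigenvalues_eq_topEig`).
[ours, bookkeeping] -/
def topIndex (v : UnitAddTorus (Fin 3) → EuclideanSpace ℝ (Fin 3)) (x : UnitAddTorus (Fin 3)) : Fin 3 :=
  Classical.choose (exists_eigenvalues_eq_topEig v x)

/-- `κ_{topIndex} = λ₁(x)`. [ours, bookkeeping] -/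
theorem eigenvalues_topIndex (v : UnitAddTorus (Fin 3) → EuclideanSpace ℝ (Fin 3)) (x : UnitAddTorus (Fin 3)) :
    (torusStrainMatrix_isHermitian v x).eigenvalues (topIndex v x) = torusStrainTopEig v x :=
  Classical.choose_spec (exists_eigenvalues_eq_topEig v x)

/-- **The squared `e₁`-column of `∇S`: `∑ₖ |S(∂ₖv)(x) u₀(x)|²`** with `u₀(x)` the eigenbasis vector of
index `topIndex v x` (on `U_s` the value does not depend on the choice: the top eigenspace is a line).
[ours, bookkeeping] -/
def topColumnSq (v : UnitAddTorus (Fin 3) → EuclideanSpace ℝ (Fin 3)) (x : UnitAddTorus (Fin 3)) : ℝ :=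
  ∑ k, (torusStrainMatrix (Torus.partialDeriv k v) x *ᵥ
        ((torusStrainMatrix_isHermitian v x).eigenvectorBasis (topIndex v x)).ofLp) ⬝ᵥ
      (torusStrainMatrix (Torus.partialDeriv k v) x *ᵥ
        ((torusStrainMatrix_isHermitian v x).eigenvectorBasis (topIndex v x)).ofLp)

/-- `topColumnSq v x ≥ 0`. [ours, bookkeeping] -/
theorem topColumnSq_nonneg (v : UnitAddTorus (Fin 3) → EuclideanSpace ℝ (Fin 3)) (x : UnitAddTorus (Fin 3)) :
    0 ≤ topColumnSq v x :=
  Finset.sum_nonneg fun _ _ => Finset.sum_nonneg fun _ _ => mul_self_nonneg _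

/-- **N14b, INTEGRATED, on fields whose top strain eigenvalue is simple everywhere:** for `v` smooth
and divergence free on `T³` with `λ₂(x) < λ₁(x)` at every `x`, and `q ≥ 5/3`,
`(2q/3) ∫ λ₁^{q−2} ∑ₖ|S(∂ₖv)u₀|² ≤ heatDissipation Φ_q v = T_q(v)` — the heat price of `Φ_q` controls
the full `e₁`-column of `∇S` (Cor. 3′(a) identity `heatDissipation_topEigMoment_eq_integral_of_midEig_lt`
and `channelIntegrand_ge_column_sq` pointwise; the channel density is integrable as
`Δ(λ₁^q) − qλ₁^{q−1}μ`). The gap class / zeros of `S` of Proposition L-λ(η) are NOT treated here.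
[ours] -/
theorem heatDissipation_topEigMoment_ge_integral_column {q : ℝ} (hq : 5 / 3 ≤ q)
    (hv : Torus.IsSmooth v) (hdiv : Torus.IsDivFree v)
    (hsimple : ∀ x : UnitAddTorus (Fin 3), torusStrainMidEig v x < torusStrainTopEig v x) :
    2 * q / 3 * ∫ x, torusStrainTopEig v x ^ (q - 2) * topColumnSq v x ≤
      heatDissipation (torusTopEigMoment q) v := by
  have hq1 : (1 : ℝ) ≤ q := by linarith
  obtain ⟨hid, -, -⟩ := heatDissipation_topEigMoment_eq_integral_of_midEig_lt hq1 hv hdiv hsimple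
  rw [hid, ← integral_const_mul]
  -- gap form everywhere, smoothness and positivity of `λ₁`
  have hgf : ∀ x : UnitAddTorus (Fin 3), ∃ (e : Fin 3 → ℝ) (lam g : ℝ), e ⬝ᵥ e = 1 ∧
      torusStrainMatrix v x *ᵥ e = lam • e ∧ 0 < g ∧
      ∀ w, w ⬝ᵥ e = 0 → w ⬝ᵥ torusStrainMatrix v x *ᵥ w ≤ (lam - g) * (w ⬝ᵥ w) := fun x => by
    obtain ⟨e, he1, hSe, hg, hgap⟩ := exists_gapForm_of_midEig_lt_topEig (hsimple x)
    exact ⟨e, _, _, he1, hSe, hg, hgap⟩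
  have hls : Torus.IsSmooth (torusStrainTopEig v) := isSmooth_torusStrainTopEig_of_simple hv hgf
  have hpos : ∀ x, 0 < torusStrainTopEig v x := fun x => by
    obtain ⟨e, lam, g, he1, hSe, hg, hgap⟩ := hgf x
    rw [torusStrainTopEig_eq_of_gapForm he1 hSe hg hgap]
    exact (lam_pos_of_gapForm_of_isDivFree hv hdiv he1 hSe hg hgap).2
  -- integrability of the channel density: it is `Δ(λ₁^q) − qλ₁^{q−1}μ`
  have hlq : Torus.IsSmooth (fun y => torusStrainTopEig v y ^ q) := isSmooth_rpow_of_pos hls hpos q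
  have hD := integrable_danskinDensity hq1 hv hv.laplacian hdiv
  have hL := hlq.laplacian.integrable
  have hint : Integrable (fun x => q * (q - 1) * torusStrainTopEig v x ^ (q - 2) *
        ∑ k, Torus.partialDeriv k (torusStrainTopEig v) x ^ 2 +
      q * torusStrainTopEig v x ^ (q - 1) * (Torus.laplacian (torusStrainTopEig v) x -
        dirTopEig (StrainL4.strainFlat v x) (StrainL4.strainFlat (Torus.laplacian v) x))) volume := by
    refine (hL.sub hD).congr (ae_of_all _ fun x => ?_)
    simp only [Pi.sub_apply]
    rw [laplacian_rpow_of_pos hls hpos q x]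
    ring
  refine integral_mono_of_nonneg (ae_of_all _ fun x => ?_) hint (ae_of_all _ fun x => ?_)
  · exact mul_nonneg (by positivity) (mul_nonneg (Real.rpow_nonneg (hpos x).le _) (topColumnSq_nonneg v x))
  · have h := channelIntegrand_ge_column_sq hq hv hdiv (hsimple x) (eigenvalues_topIndex v x)
    calc 2 * q / 3 * (torusStrainTopEig v x ^ (q - 2) * topColumnSq v x)
        = 2 * q / 3 * torusStrainTopEig v x ^ (q - 2) * topColumnSq v x := by ring
      _ ≤ _ := h

end TopEig

end Summit.NavierStokesRegularity.FunctionalMining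

end
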